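import Literature.MathematicalPhysics.QuantumFieldTheory.Balaban1983to89.B9Eq324DeltaPrimeATower
import Literature.MathematicalPhysics.QuantumFieldTheory.Balaban1983to89.B9Eq364GreenLipschitzForm
import Literature.MathematicalPhysics.QuantumFieldTheory.Balaban1983to89.B9Eq382FormRelativeNearFlat

/-!
# `Balaban1983to89.B9Eq364GreenLipschitzFormTower` — T. Bałaban, *Propagators for lattice gauge theories in a background field*, Commun. Math. Phys.
# **99** (1985) 389–434 [Balaban1985BackgroundPropagators] (3.63)–(3.64) p. 402 «G′(U′U) = G′(U)(I − V′(A)G′(U))⁻¹» with (3.24)–(3.25) p. 394 and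
# Thm 3.11 p. 416, AT `k = n+1` AVERAGING LEVELS: **THE FORM-RELATIVE LETTERS OF THE `k`-LEVEL SITE OPERATOR — `re⟨λ, Δ′_{a′,n+1}(U)λ⟩` against
# `re⟨λ, Δ′_{a′,n+1}(1)λ⟩` first order in the derivative defect `δ_D`, the coercivity of `Δ′_{a′,n+1}(U)` near the flat background, and
# `‖G′_{n+1}(U₁) − G′_{n+1}(U₂)‖ ≤ (2δ_Dγ⁻¹(√γ)⁻¹ + |a′|θ_Q(M₁ + M₂)γ⁻²)` — MODULO THE DISPLAYED LETTERS `δ_D, θ_Q, M_Q, γ`** — ne9-leaf-06's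
# `B9Eq364GreenLipschitzForm` §2 and ne9-leaf-03's `B9Thm311SitePrimeFormCoercive.re_inner_laplacePrimeA_ge_flat_sub` ONE STOREY UP on the NE9 owner's
# `B9Eq324DeltaPrimeATower` (t4-ne9-p1 gen 85); the `θ_G` letter (and the positivity `hposU`) of `B9Eq325RLipschitzSqrtTower`

statement-level skeleton of published theorems with citation tags; proofs where landed; nothing here is a claim about the Yang–Mills mass gap

PDF held: `paper:balaban1985-cmp99-background-propagators` (journal page = PDF page + 388), pp. 394, 402, 416 — through the verbatim quotations of
`B9Eq364GreenLipschitzForm` (ne9-leaf-06 gen 63) and `B9Thm311SitePrimeFormCoercive` (ne9-leaf-03 gen 62).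

CITATION HEADER (lean-in-tree rule 2026-08-18).  Audit cell `pub-balaban`, sub-cell `t4`, NE9 crux team (2): LEAF PROVER 04
(`b2b-balaban-t4-ne9-formalise-leaf-04` gen 75), INTENT-4.  Route R2′ STEP B7′ sub-step S3 in the tower currency: the `θ_G` letter and the
positivity∕coercivity of `Δ′_{a′,n+1}(U)` for this lineage's `B9Eq325RLipschitzSqrtTower`, in terms of the derivative defect `δ_D`
(`B9Eq373DerivativeRemainderL2.norm_covDerivL2K_sub_le`, lattice-generic: `√d‖η⁻¹‖ε_R`, η-free at `ε_R = K_Rαη`), the tower `Q̃′` letters `θ_Q`, `M_Q`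
(ne9-leaf-02's `B9Eq319QprimeTowerLipschitzL2.norm_QtildeTower_sub_flat_le` ∕ `norm_QtildeTower_one_le`) and the flat strong site coercivity at block `L^{n+1}` — all DISPLAYED here.

THE PRINT (verbatim, as quoted by the suppliers).  p. 402: *«G′(U′U) = G′(U)(I − V′(A)G′(U))⁻¹ (3.63) … ‖V′(A)G′(U)‖ ≤ O(1)α (3.64)»*; Thm 3.11 p. 416:
*«Δ′_a, G′ … positive definite … γ₀ independent of k»*.  Here (3.63)–(3.64) are read in the quadratic-form ∕ `L²` currency (no operator norm of `V′`).

WHAT IS PROVED (sorry-free; 0 `def`, 0 private; [folklore] finite-dimensional form bookkeeping BY NAME; nothing of [B9] asserted hypothesis-free).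
* §1 **`inner_laplacePrimeAk_eq`** (`⟨z, Δ′_{a′,n+1}(U)w⟩ = ⟨D_Uz, D_Uw⟩ + a′⟨Q̃′_{n+1}(U)z, Q̃′_{n+1}(U)w⟩`, `hRS`); `norm_covDerivL2K_le_sqrt_re_inner_k`.
* §2 **`re_inner_laplacePrimeAk_ge_flat_sub`** — with `‖D_Uλ − D_1λ‖ ≤ δ_D‖λ‖`, `‖Q̃′_{n+1}(U)λ − Q̃′_{n+1}(1)λ‖ ≤ δ_Q‖λ‖`, `‖Q̃′_{n+1}(1)λ‖ ≤ M_Q‖λ‖`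
  DISPLAYED: `re⟨λ, Δ′_{a′,n+1}(1)λ⟩ − (δ_D‖D_1λ‖² + (δ_D + δ_D² + a′δ_Q(2M_Q + δ_Q))‖λ‖²) ≤ re⟨λ, Δ′_{a′,n+1}(U)λ⟩`;
  **`coercive_laplacePrimeAk_of_letters`** — with the flat STRONG coercivity `γ_f(‖D_1λ‖² + ‖λ‖²) ≤ re⟨λ, Δ′_{a′,n+1}(1)λ⟩` displayed and
  `δ_D ≤ γ_f`: `(γ_f − (δ_D + δ_D² + a′δ_Q(2M_Q + δ_Q)))·‖λ‖² ≤ re⟨λ, Δ′_{a′,n+1}(U)λ⟩`; **`laplacePrimeAk_pos_of_letters`** (hence `Δ′_{a′,n+1}(U) > 0`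
  in the window — the `hposU` of `B9Eq325RLipschitzSqrtTower` DISCHARGED from letters).
* §3 **`norm_GpOfUk_sub_GpOfUk_le`** — `‖G′_{n+1}(U₁)y − G′_{n+1}(U₂)y‖ ≤ (2δ_Dγ⁻¹(√γ)⁻¹ + |a′|θ_Q(M₁ + M₂)γ⁻²)·‖y‖` from the displayed common
  coercivity `γ` of `Δ′_{a′,n+1}(U_i)`, `‖D_{U₂} − D_{U₁}‖ ≤ δ_D`, `‖Q̃′_{n+1}(U_i)‖ ≤ M_i`, `‖Q̃′_{n+1}(U₂) − Q̃′_{n+1}(U₁)‖ ≤ θ_Q` — ne9-leaf-06's abstract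
  `norm_greenK_sub_greenK_le_of_form` at `T_i := Δ′_{a′,n+1}(U_i)`.
MODEL ∕ DECLARED READINGS.  (M1) as `B9Eq324DeltaPrimeATower`.  (M2) every letter DISPLAYED; sizes are the suppliers' business.  (M3) NOT HERE: (3.63)'s
analyticity in `U`, any sup-norm or decay statement.
HONEST SCOPE.  [folklore] ports one storey up; the `θ_G`-letter SHAPE; «NE9 ⇐ the named binders»; NE9 NOT PRINTED ∕ NOT PROVED; NOT summit progress
(cell pub-balaban: row NE9 WALLED ON A MODEL; spine PROVED 0∕9; rung (B)+1 on a finite T⁴ — NOT infinite volume, NOT mass gap, NOT BetaPertH, NOT Clay).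
NEW file importing `B9Eq324DeltaPrimeATower` (NE9 owner) + `B9Eq364GreenLipschitzForm` (ne9-leaf-06) + `B9Eq382FormRelativeNearFlat` (ne9-leaf-03, for `norm_sq_sub_le` by name); nothing modified.  Net new unproved facts: 0.
-/

noncomputable section

open scoped InnerProductSpace ComplexConjugate BigOperators

namespace Literature.MathematicalPhysics.QuantumFieldTheory.Balaban1983to89.B9Eq364GreenLipschitzFormTower

open B4Sect5Torus (TSite)
open B9SectCLatticeCarrier (Bond)
open B9Eq311L2Pairing (WL2)
open B11Eq103H1Complex (SiteL2K greenK apply_greenK covLaplaceSiteK covDerivL2K adjoint_covDerivL2K)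
open B9Eq310HessianOperator (adTransportW)
open B9Eq315QTower (towerP)
open B9Eq326OperatorTower (QprimeTowerW)
open B9Eq324DeltaPrimeATower (laplacePrimeAk GpOfUk re_inner_laplacePrimeAk laplacePrimeAk_isSymmetric)
open B5Eq172HodgePositivity (hRS_one)
open B9Eq364GreenLipschitzForm (norm_greenK_sub_greenK_le_of_form)
open B9Eq382FormRelativeNearFlat (norm_sq_sub_le)

variable {d : ℕ} (L : ℕ) [NeZero L] (m : Fin d → ℕ) [∀ i, NeZero (m i)] (n : ℕ)
  {𝔸 : Type*} [NormedRing 𝔸] [NormedAlgebra ℂ 𝔸] [CompleteSpace 𝔸]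
  {W : Type*} [NormedAddCommGroup W] [InnerProductSpace ℂ W] [FiniteDimensional ℂ W] (φ : W ≃ₗ[ℂ] 𝔸) (c₀ : ℝ) [Fact (0 < c₀)]
  (η : ℝ) (U₁ U₂ : Bond d (towerP L m (n + 1)) → 𝔸ˣ) (c₁ : ℝ) [Fact (0 < c₁)] (a' : ℝ)
  (hRS₁ : ∀ (b : Bond d (towerP L m (n + 1))) (v u : W), ⟪adTransportW φ U₁ b v, u⟫_ℂ = ⟪v, adTransportW φ (fun b => (U₁ b)⁻¹) b u⟫_ℂ)
  (hRS₂ : ∀ (b : Bond d (towerP L m (n + 1))) (v u : W), ⟪adTransportW φ U₂ b v, u⟫_ℂ = ⟪v, adTransportW φ (fun b => (U₂ b)⁻¹) b u⟫_ℂ)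

/-! ## §1 The sesquilinear (3.24) at `n+1` levels -/

include hRS₁ in
/-- **THE SESQUILINEAR (3.24) AT `n+1` LEVELS**: `⟨z, Δ′_{a′}(U)w⟩ = ⟨D_Uz, D_Uw⟩ + a′⟨Q̃′_{n+1}(U)z, Q̃′_{n+1}(U)w⟩` for mutually adjoint transporters.
[cite: Balaban1985BackgroundPropagators, (3.23)–(3.24) p.394] -/
theorem inner_laplacePrimeAk_eq (z w : SiteL2K ℂ d (towerP L m (n + 1)) c₀ W) :
    ⟪z, laplacePrimeAk L m n φ η U₁ a' (c₁ := c₁) w⟫_ℂ =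
      ⟪covDerivL2K ℂ c₀ ((η : ℂ))⁻¹ (adTransportW φ U₁) z, covDerivL2K ℂ c₀ ((η : ℂ))⁻¹ (adTransportW φ U₁) w⟫_ℂ +
        (a' : ℂ) * ⟪((WL2.linearEquiv ℂ ℂ (fun _ : TSite d m => c₁)).symm.toLinearMap ∘ₗ QprimeTowerW L m n φ U₁ (c₀ := c₀)) z,
          ((WL2.linearEquiv ℂ ℂ (fun _ : TSite d m => c₁)).symm.toLinearMap ∘ₗ QprimeTowerW L m n φ U₁ (c₀ := c₀)) w⟫_ℂ := by
  have hc : conj (((η : ℂ))⁻¹) = ((η : ℂ))⁻¹ := by rw [map_inv₀, Complex.conj_ofReal]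
  simp only [laplacePrimeAk, covLaplaceSiteK, LinearMap.add_apply, LinearMap.smul_apply, LinearMap.comp_apply, inner_add_right, inner_smul_right]
  rw [← adjoint_covDerivL2K _ hc _ _ hRS₁, LinearMap.adjoint_inner_right, LinearMap.adjoint_inner_right]
  simp only [LinearMap.comp_apply]

include hRS₁ in
/-- `‖D_Uw‖ ≤ √re⟨w, Δ′_{a′}(U)w⟩` at `n+1` levels (`a′ ≥ 0`). [cite: Balaban1985BackgroundPropagators, (3.24) p.394] -/
theorem norm_covDerivL2K_le_sqrt_re_inner_k (ha' : 0 ≤ a') (w : SiteL2K ℂ d (towerP L m (n + 1)) c₀ W) :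
    ‖covDerivL2K ℂ c₀ ((η : ℂ))⁻¹ (adTransportW φ U₁) w‖ ≤ Real.sqrt (RCLike.re ⟪w, laplacePrimeAk L m n φ η U₁ a' (c₁ := c₁) w⟫_ℂ) := by
  rw [re_inner_laplacePrimeAk L m n φ η U₁ a' hRS₁ w]
  calc ‖covDerivL2K ℂ c₀ ((η : ℂ))⁻¹ (adTransportW φ U₁) w‖ = Real.sqrt (‖covDerivL2K ℂ c₀ ((η : ℂ))⁻¹ (adTransportW φ U₁) w‖ ^ 2) :=
        (Real.sqrt_sq (norm_nonneg _)).symm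
    _ ≤ _ := Real.sqrt_le_sqrt (le_add_of_nonneg_right (mul_nonneg ha' (sq_nonneg _)))

/-! ## §2 The near-flat step and the coercivity of `Δ′_{a′,n+1}(U)` from letters -/

section Near

variable {δD δQ MQ : ℝ} (ha' : 0 ≤ a') (hδD : 0 ≤ δD) (hδQ : 0 ≤ δQ)
  (hD : ∀ l : SiteL2K ℂ d (towerP L m (n + 1)) c₀ W, ‖covDerivL2K ℂ c₀ ((η : ℂ))⁻¹ (adTransportW φ U₁) l -
    covDerivL2K ℂ c₀ ((η : ℂ))⁻¹ (adTransportW φ (fun _ : Bond d (towerP L m (n + 1)) => (1 : 𝔸ˣ))) l‖ ≤ δD * ‖l‖)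
  (hQ : ∀ l : SiteL2K ℂ d (towerP L m (n + 1)) c₀ W,
    ‖((WL2.linearEquiv ℂ ℂ (fun _ : TSite d m => c₁)).symm.toLinearMap ∘ₗ QprimeTowerW L m n φ U₁ (c₀ := c₀)) l -
      ((WL2.linearEquiv ℂ ℂ (fun _ : TSite d m => c₁)).symm.toLinearMap ∘ₗ
        QprimeTowerW L m n φ (fun _ : Bond d (towerP L m (n + 1)) => (1 : 𝔸ˣ)) (c₀ := c₀)) l‖ ≤ δQ * ‖l‖)
  (hQ₁ : ∀ l : SiteL2K ℂ d (towerP L m (n + 1)) c₀ W,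
    ‖((WL2.linearEquiv ℂ ℂ (fun _ : TSite d m => c₁)).symm.toLinearMap ∘ₗ
        QprimeTowerW L m n φ (fun _ : Bond d (towerP L m (n + 1)) => (1 : 𝔸ˣ)) (c₀ := c₀)) l‖ ≤ MQ * ‖l‖)

include ha' hRS₁ hδD hδQ hD hQ hQ₁

/-- **THE FORM-RELATIVE NEAR-FLAT STEP FOR THE `(n+1)`-LEVEL SITE OPERATOR**: with the derivative defect `δ_D`, the `Q̃′_{n+1}`-defect `δ_Q` and the flat
norm `M_Q` DISPLAYED, `re⟨λ, Δ′_{a′}(1)λ⟩ − (δ_D‖D_1λ‖² + (δ_D + δ_D² + a′δ_Q(2M_Q + δ_Q))‖λ‖²) ≤ re⟨λ, Δ′_{a′}(U)λ⟩` — ne9-leaf-03's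
`re_inner_laplacePrimeA_ge_flat_sub` verbatim one storey up (two squares, `norm_sq_sub_le`, Young). [cite: Balaban1985BackgroundPropagators, (3.24) p.394, (3.63)–(3.64) p.402, Thm 3.11 p.416] -/
theorem re_inner_laplacePrimeAk_ge_flat_sub (lam : SiteL2K ℂ d (towerP L m (n + 1)) c₀ W) :
    RCLike.re ⟪lam, laplacePrimeAk L m n φ η (fun _ : Bond d (towerP L m (n + 1)) => (1 : 𝔸ˣ)) a' (c₁ := c₁) lam⟫_ℂ -
        (δD * ‖covDerivL2K ℂ c₀ ((η : ℂ))⁻¹ (adTransportW φ (fun _ : Bond d (towerP L m (n + 1)) => (1 : 𝔸ˣ))) lam‖ ^ 2 +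
          (δD + δD ^ 2 + a' * δQ * (2 * MQ + δQ)) * ‖lam‖ ^ 2) ≤
      RCLike.re ⟪lam, laplacePrimeAk L m n φ η U₁ a' (c₁ := c₁) lam⟫_ℂ := by
  rw [re_inner_laplacePrimeAk L m n φ η U₁ a' hRS₁,
    re_inner_laplacePrimeAk L m n φ η (fun _ : Bond d (towerP L m (n + 1)) => (1 : 𝔸ˣ)) a' (hRS_one φ)]
  set dU := covDerivL2K ℂ c₀ ((η : ℂ))⁻¹ (adTransportW φ U₁) lam with hdU
  set d1 := covDerivL2K ℂ c₀ ((η : ℂ))⁻¹ (adTransportW φ (fun _ : Bond d (towerP L m (n + 1)) => (1 : 𝔸ˣ))) lam with hd1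
  set qU := ((WL2.linearEquiv ℂ ℂ (fun _ : TSite d m => c₁)).symm.toLinearMap ∘ₗ QprimeTowerW L m n φ U₁ (c₀ := c₀)) lam with hqU
  set q1 := ((WL2.linearEquiv ℂ ℂ (fun _ : TSite d m => c₁)).symm.toLinearMap ∘ₗ
    QprimeTowerW L m n φ (fun _ : Bond d (towerP L m (n + 1)) => (1 : 𝔸ˣ)) (c₀ := c₀)) lam with hq1
  have hder : ‖d1‖ ^ 2 - ‖dU‖ ^ 2 ≤ δD * ‖lam‖ * (2 * ‖d1‖ + δD * ‖lam‖) := by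
    have h := norm_sq_sub_le dU d1
    have hd : ‖dU - d1‖ ≤ δD * ‖lam‖ := hD lam
    have h0 : 0 ≤ ‖dU - d1‖ := norm_nonneg _
    exact h.trans (mul_le_mul hd (by linarith) (by positivity) (by positivity))
  have havg : ‖q1‖ ^ 2 - ‖qU‖ ^ 2 ≤ δQ * ‖lam‖ * (2 * (MQ * ‖lam‖) + δQ * ‖lam‖) := by
    have h := norm_sq_sub_le qU q1
    have hd : ‖qU - q1‖ ≤ δQ * ‖lam‖ := hQ lam
    have h0 : 0 ≤ ‖qU - q1‖ := norm_nonneg _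
    have hq : ‖q1‖ ≤ MQ * ‖lam‖ := hQ₁ lam
    exact h.trans (mul_le_mul hd (by linarith) (by positivity) (by positivity))
  have hy : 2 * ‖lam‖ * ‖d1‖ ≤ ‖lam‖ ^ 2 + ‖d1‖ ^ 2 := by nlinarith [sq_nonneg (‖lam‖ - ‖d1‖)]
  have p1 : δD * (2 * ‖lam‖ * ‖d1‖) ≤ δD * (‖lam‖ ^ 2 + ‖d1‖ ^ 2) := mul_le_mul_of_nonneg_left hy hδD
  have havg' : a' * (‖q1‖ ^ 2 - ‖qU‖ ^ 2) ≤ a' * (δQ * ‖lam‖ * (2 * (MQ * ‖lam‖) + δQ * ‖lam‖)) := mul_le_mul_of_nonneg_left havg ha'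
  have e1 : δD * ‖lam‖ * (2 * ‖d1‖ + δD * ‖lam‖) = δD * (2 * ‖lam‖ * ‖d1‖) + δD ^ 2 * ‖lam‖ ^ 2 := by ring
  have e2 : a' * (δQ * ‖lam‖ * (2 * (MQ * ‖lam‖) + δQ * ‖lam‖)) = a' * δQ * (2 * MQ + δQ) * ‖lam‖ ^ 2 := by ring
  nlinarith [hder, havg', p1, e1, e2]

/-- **THE COERCIVITY OF `Δ′_{a′,n+1}(U)` FROM LETTERS**: with the flat STRONG site coercivity `γ_f·(‖D_1λ‖² + ‖λ‖²) ≤ re⟨λ, Δ′_{a′}(1)λ⟩` DISPLAYED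
(the flat site coercivity at block size `L^{n+1}` on the diagonal: `γ_f = 1∕(2 + 2∕a′)`, ne9-leaf-03's `flat_site_strong_coercive` one storey up) and `δ_D ≤ γ_f`:
`(γ_f − (δ_D + δ_D² + a′δ_Q(2M_Q + δ_Q)))·‖λ‖² ≤ re⟨λ, Δ′_{a′}(U)λ⟩` — the gradient row absorbs the first-order derivative defect.
[cite: Balaban1985BackgroundPropagators, Thm 3.11 p.416, (3.24) p.394, (3.63)–(3.64) p.402] -/
theorem coercive_laplacePrimeAk_of_letters {γf : ℝ} (hDγ : δD ≤ γf)
    (hflat : ∀ l : SiteL2K ℂ d (towerP L m (n + 1)) c₀ W,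
      γf * (‖covDerivL2K ℂ c₀ ((η : ℂ))⁻¹ (adTransportW φ (fun _ : Bond d (towerP L m (n + 1)) => (1 : 𝔸ˣ))) l‖ ^ 2 + ‖l‖ ^ 2) ≤
        RCLike.re ⟪l, laplacePrimeAk L m n φ η (fun _ : Bond d (towerP L m (n + 1)) => (1 : 𝔸ˣ)) a' (c₁ := c₁) l⟫_ℂ)
    (lam : SiteL2K ℂ d (towerP L m (n + 1)) c₀ W) :
    (γf - (δD + δD ^ 2 + a' * δQ * (2 * MQ + δQ))) * ‖lam‖ ^ 2 ≤ RCLike.re ⟪lam, laplacePrimeAk L m n φ η U₁ a' (c₁ := c₁) lam⟫_ℂ := by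
  have hnear := re_inner_laplacePrimeAk_ge_flat_sub L m n φ c₀ η U₁ c₁ a' hRS₁ ha' hδD hδQ hD hQ hQ₁ lam
  have hf := hflat lam
  have hD0 : 0 ≤ ‖covDerivL2K ℂ c₀ ((η : ℂ))⁻¹ (adTransportW φ (fun _ : Bond d (towerP L m (n + 1)) => (1 : 𝔸ˣ))) lam‖ ^ 2 := sq_nonneg _
  nlinarith [hnear, hf, mul_le_mul_of_nonneg_right hDγ hD0]

/-- **`Δ′_{a′,n+1}(U)` IS POSITIVE DEFINITE IN THE WINDOW `δ_D + δ_D² + a′δ_Q(2M_Q + δ_Q) < γ_f`** (with `δ_D ≤ γ_f`) — the `hposU` binder of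
`B9Eq324DeltaPrimeATower.GpOfUk` ∕ `B9Eq325RLipschitzSqrtTower` DISCHARGED from the letters (cf. the owner's `laplacePrimeAk_pos_of_coercive'`). [cite: Balaban1985BackgroundPropagators, Thm 3.11 p.416, (3.24)–(3.25) p.394] -/
theorem laplacePrimeAk_pos_of_letters {γf : ℝ} (hDγ : δD ≤ γf) (hwin : δD + δD ^ 2 + a' * δQ * (2 * MQ + δQ) < γf)
    (hflat : ∀ l : SiteL2K ℂ d (towerP L m (n + 1)) c₀ W,
      γf * (‖covDerivL2K ℂ c₀ ((η : ℂ))⁻¹ (adTransportW φ (fun _ : Bond d (towerP L m (n + 1)) => (1 : 𝔸ˣ))) l‖ ^ 2 + ‖l‖ ^ 2) ≤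
        RCLike.re ⟪l, laplacePrimeAk L m n φ η (fun _ : Bond d (towerP L m (n + 1)) => (1 : 𝔸ˣ)) a' (c₁ := c₁) l⟫_ℂ)
    (x : SiteL2K ℂ d (towerP L m (n + 1)) c₀ W) (hx : x ≠ 0) :
    0 < RCLike.re ⟪x, laplacePrimeAk L m n φ η U₁ a' (c₁ := c₁) x⟫_ℂ := by
  have h := coercive_laplacePrimeAk_of_letters L m n φ c₀ η U₁ c₁ a' hRS₁ ha' hδD hδQ hD hQ hQ₁ hDγ hflat x
  have hx2 : 0 < ‖x‖ ^ 2 := by positivity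
  nlinarith

end Near

/-! ## §3 The `θ_G` letter: `G′_{n+1}(U₁)` against `G′_{n+1}(U₂)` from `δ_D`, `θ_Q`, `M_i` and the displayed coercivity `γ` -/

section ThetaG

variable (hpos₁ : ∀ x : SiteL2K ℂ d (towerP L m (n + 1)) c₀ W, x ≠ 0 → 0 < RCLike.re ⟪x, laplacePrimeAk L m n φ η U₁ a' (c₁ := c₁) x⟫_ℂ)
  (hpos₂ : ∀ x : SiteL2K ℂ d (towerP L m (n + 1)) c₀ W, x ≠ 0 → 0 < RCLike.re ⟪x, laplacePrimeAk L m n φ η U₂ a' (c₁ := c₁) x⟫_ℂ)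
  {γ δD M₁ M₂ θQ : ℝ} (ha' : 0 ≤ a') (hγ : 0 < γ) (hδD : 0 ≤ δD) (hM₁ : 0 ≤ M₁) (hM₂ : 0 ≤ M₂) (hθQ : 0 ≤ θQ)
  (hc₁ : ∀ x, γ * ‖x‖ ^ 2 ≤ RCLike.re ⟪x, laplacePrimeAk L m n φ η U₁ a' (c₀ := c₀) (c₁ := c₁) x⟫_ℂ)
  (hc₂ : ∀ x, γ * ‖x‖ ^ 2 ≤ RCLike.re ⟪x, laplacePrimeAk L m n φ η U₂ a' (c₀ := c₀) (c₁ := c₁) x⟫_ℂ)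
  (hD : ∀ x : SiteL2K ℂ d (towerP L m (n + 1)) c₀ W,
    ‖covDerivL2K ℂ c₀ ((η : ℂ))⁻¹ (adTransportW φ U₂) x - covDerivL2K ℂ c₀ ((η : ℂ))⁻¹ (adTransportW φ U₁) x‖ ≤ δD * ‖x‖)
  (hQ₁ : ∀ x, ‖((WL2.linearEquiv ℂ ℂ (fun _ : TSite d m => c₁)).symm.toLinearMap ∘ₗ QprimeTowerW L m n φ U₁ (c₀ := c₀)) x‖ ≤ M₁ * ‖x‖)
  (hQ₂ : ∀ x, ‖((WL2.linearEquiv ℂ ℂ (fun _ : TSite d m => c₁)).symm.toLinearMap ∘ₗ QprimeTowerW L m n φ U₂ (c₀ := c₀)) x‖ ≤ M₂ * ‖x‖)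
  (hdQ : ∀ x, ‖((WL2.linearEquiv ℂ ℂ (fun _ : TSite d m => c₁)).symm.toLinearMap ∘ₗ QprimeTowerW L m n φ U₂ (c₀ := c₀)) x -
    ((WL2.linearEquiv ℂ ℂ (fun _ : TSite d m => c₁)).symm.toLinearMap ∘ₗ QprimeTowerW L m n φ U₁ (c₀ := c₀)) x‖ ≤ θQ * ‖x‖)

include hRS₁ hRS₂ ha' hγ hδD hM₁ hM₂ hθQ hc₁ hc₂ hD hQ₁ hQ₂ hdQ in
/-- **`‖G′_{n+1}(U₁)y − G′_{n+1}(U₂)y‖ ≤ (2δ_D·γ⁻¹(√γ)⁻¹ + |a′|·θ_Q(M₁ + M₂)·γ⁻²)·‖y‖` — THE `θ_G` LETTER OF `B9Eq325RLipschitzSqrtTower` PRODUCED at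
`n+1` levels** from the DISPLAYED common coercivity `γ` of `Δ′_{a′}(U_i)`, the `D`-difference `δ_D` and the `Q̃′_{n+1}`-letters `M_i`, `θ_Q`: ne9-leaf-06's
abstract `norm_greenK_sub_greenK_le_of_form` at `T_i := Δ′_{a′,n+1}(U_i)` with the form difference split as
`⟨(D₁−D₂)z, D₁w⟩ + ⟨D₂z, (D₁−D₂)w⟩ + a′[⟨(Q̃′₁−Q̃′₂)z, Q̃′₁w⟩ + ⟨Q̃′₂z, (Q̃′₁−Q̃′₂)w⟩]` — their one-step `norm_GpOfU_sub_GpOfU_le` verbatim one storey up.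
[cite: Balaban1985BackgroundPropagators, (3.63)–(3.64) p.402, (3.24)–(3.25) p.394] -/
theorem norm_GpOfUk_sub_GpOfUk_le (y : SiteL2K ℂ d (towerP L m (n + 1)) c₀ W) :
    ‖GpOfUk L m n φ η U₁ a' (c₁ := c₁) hpos₁ y - GpOfUk L m n φ η U₂ a' (c₁ := c₁) hpos₂ y‖ ≤
      (2 * δD * (γ⁻¹ * (Real.sqrt γ)⁻¹) + (|a'| * θQ * (M₁ + M₂)) * γ⁻¹ ^ 2) * ‖y‖ := by
  rw [norm_sub_rev]
  set D₁ := covDerivL2K ℂ c₀ ((η : ℂ))⁻¹ (adTransportW φ U₁) with hD₁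
  set D₂ := covDerivL2K ℂ c₀ ((η : ℂ))⁻¹ (adTransportW φ U₂) with hD₂
  set P₁ := (WL2.linearEquiv ℂ ℂ (fun _ : TSite d m => c₁)).symm.toLinearMap ∘ₗ QprimeTowerW L m n φ U₁ (c₀ := c₀) with hP₁
  set P₂ := (WL2.linearEquiv ℂ ℂ (fun _ : TSite d m => c₁)).symm.toLinearMap ∘ₗ QprimeTowerW L m n φ U₂ (c₀ := c₀) with hP₂
  have hform : ∀ z w : SiteL2K ℂ d (towerP L m (n + 1)) c₀ W,
      ‖⟪z, laplacePrimeAk L m n φ η U₁ a' (c₁ := c₁) w⟫_ℂ - ⟪z, laplacePrimeAk L m n φ η U₂ a' (c₁ := c₁) w⟫_ℂ‖ ≤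
        δD * (‖z‖ * Real.sqrt (RCLike.re ⟪w, laplacePrimeAk L m n φ η U₁ a' (c₁ := c₁) w⟫_ℂ) +
          Real.sqrt (RCLike.re ⟪z, laplacePrimeAk L m n φ η U₂ a' (c₁ := c₁) z⟫_ℂ) * ‖w‖) + |a'| * θQ * (M₁ + M₂) * (‖z‖ * ‖w‖) := by
    intro z w
    rw [inner_laplacePrimeAk_eq L m n φ c₀ η U₁ c₁ a' hRS₁ z w, inner_laplacePrimeAk_eq L m n φ c₀ η U₂ c₁ a' hRS₂ z w]
    have hsplit : ⟪D₁ z, D₁ w⟫_ℂ + (a' : ℂ) * ⟪P₁ z, P₁ w⟫_ℂ - (⟪D₂ z, D₂ w⟫_ℂ + (a' : ℂ) * ⟪P₂ z, P₂ w⟫_ℂ) =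
        (⟪D₁ z - D₂ z, D₁ w⟫_ℂ + ⟪D₂ z, D₁ w - D₂ w⟫_ℂ) + (a' : ℂ) * (⟪P₁ z - P₂ z, P₁ w⟫_ℂ + ⟪P₂ z, P₁ w - P₂ w⟫_ℂ) := by
      simp only [inner_sub_left, inner_sub_right]; ring
    have hDzw : ‖D₁ z - D₂ z‖ ≤ δD * ‖z‖ := by rw [← norm_neg, neg_sub]; exact hD z
    have hDw : ‖D₁ w - D₂ w‖ ≤ δD * ‖w‖ := by rw [← norm_neg, neg_sub]; exact hD w
    have hPz : ‖P₁ z - P₂ z‖ ≤ θQ * ‖z‖ := by rw [← norm_neg, neg_sub]; exact hdQ z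
    have hPw : ‖P₁ w - P₂ w‖ ≤ θQ * ‖w‖ := by rw [← norm_neg, neg_sub]; exact hdQ w
    have hE₁ : ‖D₁ w‖ ≤ Real.sqrt (RCLike.re ⟪w, laplacePrimeAk L m n φ η U₁ a' (c₁ := c₁) w⟫_ℂ) :=
      norm_covDerivL2K_le_sqrt_re_inner_k L m n φ c₀ η U₁ c₁ a' hRS₁ ha' w
    have hE₂ : ‖D₂ z‖ ≤ Real.sqrt (RCLike.re ⟪z, laplacePrimeAk L m n φ η U₂ a' (c₁ := c₁) z⟫_ℂ) :=
      norm_covDerivL2K_le_sqrt_re_inner_k L m n φ c₀ η U₂ c₁ a' hRS₂ ha' z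
    show ‖⟪D₁ z, D₁ w⟫_ℂ + (a' : ℂ) * ⟪P₁ z, P₁ w⟫_ℂ - (⟪D₂ z, D₂ w⟫_ℂ + (a' : ℂ) * ⟪P₂ z, P₂ w⟫_ℂ)‖ ≤ _
    rw [hsplit]
    calc _ ≤ ‖⟪D₁ z - D₂ z, D₁ w⟫_ℂ + ⟪D₂ z, D₁ w - D₂ w⟫_ℂ‖ + ‖(a' : ℂ) * (⟪P₁ z - P₂ z, P₁ w⟫_ℂ + ⟪P₂ z, P₁ w - P₂ w⟫_ℂ)‖ := norm_add_le _ _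
      _ ≤ (‖D₁ z - D₂ z‖ * ‖D₁ w‖ + ‖D₂ z‖ * ‖D₁ w - D₂ w‖) + |a'| * (‖P₁ z - P₂ z‖ * ‖P₁ w‖ + ‖P₂ z‖ * ‖P₁ w - P₂ w‖) := by
          refine add_le_add ((norm_add_le _ _).trans (add_le_add (norm_inner_le_norm _ _) (norm_inner_le_norm _ _))) ?_
          rw [norm_mul, Complex.norm_real, Real.norm_eq_abs]
          exact mul_le_mul_of_nonneg_left ((norm_add_le _ _).trans (add_le_add (norm_inner_le_norm _ _) (norm_inner_le_norm _ _))) (abs_nonneg _)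
      _ ≤ (δD * ‖z‖ * Real.sqrt (RCLike.re ⟪w, laplacePrimeAk L m n φ η U₁ a' (c₁ := c₁) w⟫_ℂ) +
            Real.sqrt (RCLike.re ⟪z, laplacePrimeAk L m n φ η U₂ a' (c₁ := c₁) z⟫_ℂ) * (δD * ‖w‖)) +
          |a'| * (θQ * ‖z‖ * (M₁ * ‖w‖) + M₂ * ‖z‖ * (θQ * ‖w‖)) := by
          gcongr
          · exact hQ₁ w
          · exact hQ₂ z
      _ = _ := by ring
  have h := norm_greenK_sub_greenK_le_of_form (𝕜 := ℂ) hγ hpos₁ hpos₂ hc₁ hc₂ (laplacePrimeAk_isSymmetric L m n φ η U₂ a' hRS₂) hδD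
    (by positivity : 0 ≤ |a'| * θQ * (M₁ + M₂)) hform y
  unfold GpOfUk
  exact h

end ThetaG

end Literature.MathematicalPhysics.QuantumFieldTheory.Balaban1983to89.B9Eq364GreenLipschitzFormTower

end
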